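import Summits.Ventures.LatticeQCDFlow.Scoring.SU2ClassFunctionConvolution
import HarnessLib

/-!
# SU(2): the pure part `X = U − a₀·1`, the conjugator `h = r²·1 − X₂X₁` (two elements with the same trace are conjugate), and the adjoint-action identity `a₀(C⁻¹UCU⁻¹) = (2a₀(C)² − 1) + 2(1 − a₀(C)²)a₀(U)² + 2⟨x⃗(U), x⃗(C)⟩²`

HONEST FRAMING: exact (Metropolis-corrected) sampling algorithms for lattice gauge theory;
figures of merit are autocorrelation/cost numbers at stated couplings and volumes; no
continuum-physics claim.

Venture `LatticeQCDFlow` (cell pub-lqcd), sub-topic `Scoring`; FANOUT row 5 (`s0-sun-a`), GEN-9.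
NEW WORK of the cell (placement rule).  Step 5a of row 5's route to the exact SU(2) torus formula:
the algebra of the ADJOINT ACTION needed for the handle identity
`∫ χ_n(A U B U⁻¹) dU = χ_n(A)χ_n(B)/(n+1)` — the last group-theoretic input of the 2-d character
expansion on a closed surface (a link occurring twice in one face).

* §1 **`su2a0_mul_eq`** — `a₀(A·M) = a₀(A)a₀(M) − ⟨x⃗(A), x⃗(M)⟩` (and `x⃗(A⁻¹) = −x⃗(A)`);
  **`su2a0_commutator_eq`** — `a₀(C⁻¹UCU⁻¹) = (2a₀(C)² − 1) + 2(1 − a₀(C)²)·a₀(U)² + 2⟨x⃗(U), x⃗(C)⟩²`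
  (`= 1 − 2‖x⃗(C)‖²·(1 − a₀(U)² − ⟨ĉ, x⃗(U)⟩²)`: the cosine of the rotation of the axis of `C` by `U`
  depends on `U` only through `a₀(U)² + ⟨ĉ, x⃗(U)⟩²`).
* §2 **`su2Pure`** bookkeeping without a definition: the pure part `X = U − a₀·1` squares to
  `−(1 − a₀²)·1` (`pure_mul_pure`, Cayley–Hamilton for SU(2)).
* §3 **`exists_conj_eq`** — TWO ELEMENTS OF SU(2) WITH THE SAME `a₀` ARE CONJUGATE: if
  `a₀(B₁) = a₀(B₂)` and `x⃗(B₂) ≠ −x⃗(B₁)` then `g B₁ g⁻¹ = B₂` for the unit part `g` of the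
  quaternion `h = r²·1 − X₂X₁` (`r² = 1 − a₀²`; `hX₁ = X₂h`, `conjugator_mul_of_sq`; `h ≠ 0` because
  the pure parts are not antipodal).  The antipodal case is what the handle identity avoids by the
  symmetry `s ↦ −s` of the uniform law (next file).

No new definition (the pure part and `h` are written out); nothing cited (quaternion folklore).
-/

noncomputable section

open Real MeasureTheory Set Metric
open Literature.MathematicalPhysics.QuantumFieldTheory Literature.MathematicalPhysics.QuantumLattice
open Summit.Ventures.LatticeQCDFlow.Exactness
open scoped RealInnerProductSpace Matrix

namespace Summit.Ventures.LatticeQCDFlow.Scoring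

/-! ## §1. Products and the adjoint action in the quaternion coordinates -/

/-- `x_k(A⁻¹) = −x_k(A)` for each generator coordinate (`Z_kᴴ = −Z_k`). -/
theorem su2x_inv (Z : Matrix (Fin 2) (Fin 2) ℂ) (hZ : Zᴴ = -Z) (A : Matrix.specialUnitaryGroup (Fin 2) ℂ) :
    su2x Z A⁻¹ = -su2x Z A := by
  have hinv : ((A⁻¹ : Matrix.specialUnitaryGroup (Fin 2) ℂ) : Matrix (Fin 2) (Fin 2) ℂ) =
      (A : Matrix (Fin 2) (Fin 2) ℂ)ᴴ := rfl
  have h1 : (Z * (A : Matrix (Fin 2) (Fin 2) ℂ)ᴴ).trace = -star ((Z * (A : Matrix (Fin 2) (Fin 2) ℂ)).trace) := by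
    rw [← Matrix.trace_conjTranspose, Matrix.conjTranspose_mul, hZ, Matrix.mul_neg, Matrix.trace_neg,
      Matrix.trace_mul_comm, neg_neg]
  rw [su2x, su2x, hinv, h1, Complex.star_def, Complex.neg_re, Complex.conj_re]
  ring

/-- `x⃗(A⁻¹) = −x⃗(A)`. -/
theorem su2vec_inv (A : Matrix.specialUnitaryGroup (Fin 2) ℂ) : su2vec A⁻¹ = -su2vec A := by
  ext j
  fin_cases j <;> simp [su2vec, su2x_inv _ genZ1_props.1, su2x_inv _ genZ2_props.1, su2x_inv _ genZ3_props.1]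

/-- **`a₀(A·M) = a₀(A)a₀(M) − ⟨x⃗(A), x⃗(M)⟩`** (the real part of a quaternion product). -/
theorem su2a0_mul_eq (A M : Matrix.specialUnitaryGroup (Fin 2) ℂ) :
    su2a0 (A * M) = su2a0 A * su2a0 M - ⟪su2vec A, su2vec M⟫ := by
  have h := su2a0_inv_mul_eq_inner A⁻¹ M
  rw [inv_inv, su2a0_inv, su2vec_inv, inner_neg_left] at h
  rw [h]; ring

/-- **The adjoint-action identity**: for all `C, U ∈ SU(2)`,
`a₀(C⁻¹·U·C·U⁻¹) = (2a₀(C)² − 1) + 2(1 − a₀(C)²)·a₀(U)² + 2⟨x⃗(U), x⃗(C)⟩²`.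
(Raw form: `a₀(C†UCU†) = a₀(C)²‖u‖² − ‖c⃗‖²‖u‖² + 2‖c⃗‖²u₀² + 2(u⃗·c⃗)²`, a polynomial identity in the
eight coordinates; then `‖u‖ = 1`, `a₀(C)² + ‖c⃗‖² = 1`.) -/
theorem su2a0_commutator_eq (C U : Matrix.specialUnitaryGroup (Fin 2) ℂ) :
    su2a0 (C⁻¹ * U * C * U⁻¹) = (2 * su2a0 C ^ 2 - 1) + 2 * (1 - su2a0 C ^ 2) * su2a0 U ^ 2 +
      2 * (su2x genZ1 U * su2x genZ1 C + su2x genZ2 U * su2x genZ2 C + su2x genZ3 U * su2x genZ3 C) ^ 2 := by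
  have hc := IsQuat.of_mem_specialUnitaryGroup C.2
  have hu := IsQuat.of_mem_specialUnitaryGroup U.2
  have hC := su2_sum_sq C
  have hU := su2_sum_sq U
  have hinvC : ((C⁻¹ : Matrix.specialUnitaryGroup (Fin 2) ℂ) : Matrix (Fin 2) (Fin 2) ℂ) =
      star (C : Matrix (Fin 2) (Fin 2) ℂ) := rfl
  have hinvU : ((U⁻¹ : Matrix.specialUnitaryGroup (Fin 2) ℂ) : Matrix (Fin 2) (Fin 2) ℂ) =
      star (U : Matrix (Fin 2) (Fin 2) ℂ) := rfl
  -- the raw polynomial identity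
  have raw : su2a0 (C⁻¹ * U * C * U⁻¹) =
      su2a0 C ^ 2 * (su2a0 U ^ 2 + su2x genZ1 U ^ 2 + su2x genZ2 U ^ 2 + su2x genZ3 U ^ 2) -
      (su2x genZ1 C ^ 2 + su2x genZ2 C ^ 2 + su2x genZ3 C ^ 2) *
        (su2a0 U ^ 2 + su2x genZ1 U ^ 2 + su2x genZ2 U ^ 2 + su2x genZ3 U ^ 2) +
      2 * (su2x genZ1 C ^ 2 + su2x genZ2 C ^ 2 + su2x genZ3 C ^ 2) * su2a0 U ^ 2 +
      2 * (su2x genZ1 U * su2x genZ1 C + su2x genZ2 U * su2x genZ2 C + su2x genZ3 U * su2x genZ3 C) ^ 2 := by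
    simp only [su2a0, su2x, Submonoid.coe_mul, hinvC, hinvU, genZ1, genZ2, genZ3, Matrix.trace_fin_two,
      Matrix.mul_apply, Fin.sum_univ_two, Matrix.star_apply, Matrix.of_apply, Matrix.cons_val',
      Matrix.cons_val_zero, Matrix.cons_val_one, Matrix.empty_val', Matrix.cons_val_fin_one,
      hc.diag, hc.offdiag, hu.diag, hu.offdiag, RCLike.star_def, Complex.add_re, Complex.mul_re,
      Complex.add_im, Complex.mul_im, Complex.I_re, Complex.I_im, Complex.conj_re, Complex.conj_im,
      Complex.neg_re, Complex.neg_im, map_neg, Complex.conj_conj,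
      Complex.zero_re, Complex.zero_im, Complex.one_re, Complex.one_im]
    ring
  rw [raw]
  linear_combination (su2a0 C ^ 2 - (su2x genZ1 C ^ 2 + su2x genZ2 C ^ 2 + su2x genZ3 C ^ 2)) * hU -
    (1 - 2 * su2a0 U ^ 2) * hC

/-- The adjoint-action identity with inner products:
`a₀(C⁻¹UCU⁻¹) = (2a₀(C)² − 1) + 2(1 − a₀(C)²)·a₀(U)² + 2⟨x⃗(U), x⃗(C)⟩²`. -/
theorem su2a0_commutator_eq_inner (C U : Matrix.specialUnitaryGroup (Fin 2) ℂ) :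
    su2a0 (C⁻¹ * U * C * U⁻¹) = (2 * su2a0 C ^ 2 - 1) + 2 * (1 - su2a0 C ^ 2) * su2a0 U ^ 2 +
      2 * ⟪su2vec U, su2vec C⟫ ^ 2 := by
  rw [su2a0_commutator_eq, inner_su2vec_su2vec]

/-! ## §2. The pure part `X = U − a₀·1` -/

/-- **Cayley–Hamilton for SU(2)**: the pure part squares to a negative scalar,
`(U − a₀·1)² = −(1 − a₀²)·1`. -/
theorem pure_mul_pure (B : Matrix.specialUnitaryGroup (Fin 2) ℂ) :
    ((B : Matrix (Fin 2) (Fin 2) ℂ) - ((su2a0 B : ℝ) : ℂ) • (1 : Matrix (Fin 2) (Fin 2) ℂ)) *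
        ((B : Matrix (Fin 2) (Fin 2) ℂ) - ((su2a0 B : ℝ) : ℂ) • 1) =
      -(((1 - su2a0 B ^ 2 : ℝ) : ℂ) • (1 : Matrix (Fin 2) (Fin 2) ℂ)) := by
  have hb := IsQuat.of_mem_specialUnitaryGroup B.2
  have hn := IsQuat.normSq_eq_one_of_mem B.2
  unfold IsQuat.normSq at hn
  rw [Complex.normSq_apply, Complex.normSq_apply] at hn
  rw [show ((1 - su2a0 B ^ 2 : ℝ) : ℂ) = 1 - (su2a0 B : ℂ) * (su2a0 B : ℂ) by push_cast; ring]
  ext i j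
  fin_cases i <;> fin_cases j <;>
  · apply Complex.ext <;>
    · simp [Matrix.mul_apply, Fin.sum_univ_two, su2a0, Matrix.trace_fin_two, hb.diag, hb.offdiag,
        Complex.add_re, Complex.mul_re, Complex.add_im, Complex.mul_im, Complex.conj_re,
        Complex.conj_im, Matrix.one_apply, Complex.sub_re, Complex.sub_im, Complex.ofReal_re,
        Complex.ofReal_im]
      nlinarith [hn]

/-- `x_Z(B)` only sees the pure part: `x_Z(B) = −Re tr(Z·(B − a₀·1))/2` for traceless `Z`. -/
theorem su2x_eq_pure (Z : Matrix (Fin 2) (Fin 2) ℂ) (hZ : Z.trace = 0)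
    (B : Matrix.specialUnitaryGroup (Fin 2) ℂ) :
    su2x Z B = -((Z * ((B : Matrix (Fin 2) (Fin 2) ℂ) - ((su2a0 B : ℝ) : ℂ) • 1)).trace.re) / 2 := by
  rw [su2x, Matrix.mul_sub, Matrix.trace_sub, Matrix.mul_smul, Matrix.mul_one, Matrix.trace_smul, hZ,
    smul_zero, sub_zero]

/-- The coordinates of `x⃗(B)` through the pure part. -/
theorem su2vec_apply_eq_pure (B : Matrix.specialUnitaryGroup (Fin 2) ℂ) (k : Fin 3) :
    su2vec B k = -((![genZ1, genZ2, genZ3] k *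
      ((B : Matrix (Fin 2) (Fin 2) ℂ) - ((su2a0 B : ℝ) : ℂ) • 1)).trace.re) / 2 := by
  fin_cases k
  · simpa [su2vec] using su2x_eq_pure genZ1 genZ1_props.2.1 B
  · simpa [su2vec] using su2x_eq_pure genZ2 genZ2_props.2.1 B
  · simpa [su2vec] using su2x_eq_pure genZ3 genZ3_props.2.1 B

/-- Noncommutative algebra of the conjugator: if `X₁² = X₂² = −r·1` then
`(r·1 − X₂X₁)·X₁ = X₂·(r·1 − X₂X₁)` (both sides equal `r·X₁ + r·X₂`). -/
theorem conjugator_mul_of_sq (X₁ X₂ : Matrix (Fin 2) (Fin 2) ℂ) (r : ℂ)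
    (h1 : X₁ * X₁ = -(r • (1 : Matrix (Fin 2) (Fin 2) ℂ))) (h2 : X₂ * X₂ = -(r • (1 : Matrix (Fin 2) (Fin 2) ℂ))) :
    (r • (1 : Matrix (Fin 2) (Fin 2) ℂ) - X₂ * X₁) * X₁ = X₂ * (r • (1 : Matrix (Fin 2) (Fin 2) ℂ) - X₂ * X₁) := by
  have hl : (r • (1 : Matrix (Fin 2) (Fin 2) ℂ) - X₂ * X₁) * X₁ = r • X₁ + r • X₂ := by
    rw [Matrix.sub_mul, Matrix.smul_mul, Matrix.one_mul, Matrix.mul_assoc, h1, Matrix.mul_neg,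
      Matrix.mul_smul, Matrix.mul_one, sub_neg_eq_add]
  have hr : X₂ * (r • (1 : Matrix (Fin 2) (Fin 2) ℂ) - X₂ * X₁) = r • X₂ + r • X₁ := by
    rw [Matrix.mul_sub, Matrix.mul_smul, Matrix.mul_one, ← Matrix.mul_assoc, h2, Matrix.neg_mul,
      Matrix.smul_mul, Matrix.one_mul, sub_neg_eq_add]
  rw [hl, hr, add_comm]

/-! ## §3. Conjugacy of elements with the same `a₀` -/

/-- **Conjugacy in SU(2)**: if `a₀(B₁) = a₀(B₂)` and the pure parts are not antipodal
(`x⃗(B₂) ≠ −x⃗(B₁)`), then `g B₁ g⁻¹ = B₂` for some `g ∈ SU(2)` (the unit part of the quaternion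
`h = r²·1 − X₂X₁`, `X_i = B_i − a₀·1`, `r² = 1 − a₀²`). -/
theorem exists_conj_eq (B₁ B₂ : Matrix.specialUnitaryGroup (Fin 2) ℂ) (ha : su2a0 B₁ = su2a0 B₂)
    (hne : su2vec B₂ ≠ -su2vec B₁) :
    ∃ g : Matrix.specialUnitaryGroup (Fin 2) ℂ, g * B₁ * g⁻¹ = B₂ := by
  obtain ⟨X₁, hX₁⟩ : ∃ X : Matrix (Fin 2) (Fin 2) ℂ,
      X = (B₁ : Matrix (Fin 2) (Fin 2) ℂ) - ((su2a0 B₁ : ℝ) : ℂ) • 1 := ⟨_, rfl⟩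
  obtain ⟨X₂, hX₂⟩ : ∃ X : Matrix (Fin 2) (Fin 2) ℂ,
      X = (B₂ : Matrix (Fin 2) (Fin 2) ℂ) - ((su2a0 B₂ : ℝ) : ℂ) • 1 := ⟨_, rfl⟩
  obtain ⟨r, hr⟩ : ∃ r : ℝ, r = 1 - su2a0 B₁ ^ 2 := ⟨_, rfl⟩
  have hsq1 : X₁ * X₁ = -((r : ℂ) • (1 : Matrix (Fin 2) (Fin 2) ℂ)) := by
    rw [hX₁, hr]; exact pure_mul_pure B₁
  have hsq2 : X₂ * X₂ = -((r : ℂ) • (1 : Matrix (Fin 2) (Fin 2) ℂ)) := by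
    rw [hX₂, hr, ha]; exact pure_mul_pure B₂
  have hq1 : IsQuat X₁ := by
    have h := (IsQuat.of_mem_specialUnitaryGroup B₁.2).add ((IsQuat.one).smul_real (-su2a0 B₁))
    rw [hX₁, sub_eq_add_neg, ← neg_smul, ← Complex.ofReal_neg]; exact h
  have hq2 : IsQuat X₂ := by
    have h := (IsQuat.of_mem_specialUnitaryGroup B₂.2).add ((IsQuat.one).smul_real (-su2a0 B₂))
    rw [hX₂, sub_eq_add_neg, ← neg_smul, ← Complex.ofReal_neg]; exact h
  obtain ⟨h, hh⟩ : ∃ h : Matrix (Fin 2) (Fin 2) ℂ, h = ((r : ℂ) • (1 : Matrix (Fin 2) (Fin 2) ℂ)) - X₂ * X₁ :=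
    ⟨_, rfl⟩
  have hqh : IsQuat h := by
    have h' := ((IsQuat.one).smul_real r).add (((hq2.mul hq1)).smul_real (-1))
    rw [hh, sub_eq_add_neg, ← neg_one_smul ℂ (X₂ * X₁)]
    convert h' using 2
    norm_num
  have hint : h * X₁ = X₂ * h := by rw [hh]; exact conjugator_mul_of_sq X₁ X₂ r hsq1 hsq2
  -- `h ≠ 0`
  have hh0 : h ≠ 0 := by
    intro h0
    have hXX : X₂ * X₁ = (r : ℂ) • (1 : Matrix (Fin 2) (Fin 2) ℂ) := by
      rw [hh] at h0; exact (sub_eq_zero.mp h0).symm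
    have h3 : -((r : ℂ) • X₂) = (r : ℂ) • X₁ := by
      have h4 := congrArg (· * X₁) hXX
      simp only [Matrix.mul_assoc, hsq1, Matrix.mul_neg, Matrix.mul_smul, Matrix.mul_one,
        Matrix.smul_mul, Matrix.one_mul] at h4
      exact h4
    rcases eq_or_ne r 0 with hr0 | hr0
    · have hn1 : su2vec B₁ = 0 := by
        have h5 := norm_su2vec_sq B₁
        rw [← hr, hr0] at h5
        exact norm_eq_zero.mp (by nlinarith [norm_nonneg (su2vec B₁), h5])
      have hn2 : su2vec B₂ = 0 := by
        have h5 := norm_su2vec_sq B₂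
        rw [← ha, ← hr, hr0] at h5
        exact norm_eq_zero.mp (by nlinarith [norm_nonneg (su2vec B₂), h5])
      exact hne (by rw [hn1, hn2, neg_zero])
    · have hX : X₂ = -X₁ := by
        have hrc : (r : ℂ) ≠ 0 := Complex.ofReal_ne_zero.mpr hr0
        have h5 := congrArg (fun M : Matrix (Fin 2) (Fin 2) ℂ => ((r : ℂ)⁻¹) • M) h3
        simp only [smul_neg, smul_smul, inv_mul_cancel₀ hrc, one_smul] at h5
        rw [← neg_neg X₂, h5]
      apply hne
      ext k
      rw [PiLp.neg_apply, su2vec_apply_eq_pure, su2vec_apply_eq_pure, ← hX₁, ← hX₂, hX, Matrix.mul_neg,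
        Matrix.trace_neg, Complex.neg_re]
      ring
  -- the unit part of `h` conjugates `B₁` to `B₂`
  have hnq : IsQuat.normSq h ≠ 0 := fun h0 => hh0 (hqh.eq_zero_of_normSq h0)
  refine ⟨⟨quatUnit h, quatUnit_mem hqh⟩, ?_⟩
  rw [mul_inv_eq_iff_eq_mul]
  apply Subtype.ext
  simp only [Submonoid.coe_mul]
  have hB : h * (B₁ : Matrix (Fin 2) (Fin 2) ℂ) = (B₂ : Matrix (Fin 2) (Fin 2) ℂ) * h := by
    have e1 : (B₁ : Matrix (Fin 2) (Fin 2) ℂ) = X₁ + ((su2a0 B₁ : ℝ) : ℂ) • 1 := by rw [hX₁]; abel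
    have e2 : (B₂ : Matrix (Fin 2) (Fin 2) ℂ) = X₂ + ((su2a0 B₁ : ℝ) : ℂ) • 1 := by rw [hX₂, ha]; abel
    rw [e1, e2, Matrix.mul_add, Matrix.add_mul, hint, Matrix.mul_smul, Matrix.mul_one, Matrix.smul_mul,
      Matrix.one_mul]
  have hpolar := quatUnit_smul hqh
  have hk : ((Real.sqrt (IsQuat.normSq h) : ℝ) : ℂ) ≠ 0 := by
    have : 0 < IsQuat.normSq h := lt_of_le_of_ne (IsQuat.normSq_nonneg h) (Ne.symm hnq)
    exact Complex.ofReal_ne_zero.mpr (Real.sqrt_pos.mpr this).ne'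
  have key : ((Real.sqrt (IsQuat.normSq h) : ℝ) : ℂ) • (quatUnit h * (B₁ : Matrix (Fin 2) (Fin 2) ℂ)) =
      ((Real.sqrt (IsQuat.normSq h) : ℝ) : ℂ) • ((B₂ : Matrix (Fin 2) (Fin 2) ℂ) * quatUnit h) := by
    rw [← Matrix.smul_mul, ← Matrix.mul_smul, hpolar, hB]
  exact smul_right_injective (Matrix (Fin 2) (Fin 2) ℂ) hk key

end Summit.Ventures.LatticeQCDFlow.Scoring
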